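import Mathlib.NumberTheory.NumberField.CMField
import HarnessLib

/-!
# Deep units of a CM field are torsion-free and real

Helper file for the crux `HalfIntegralTwistCM` (stmt-Langlands-14036) of the route
`IrreducibilityBySelfDuality`, line `two-primary-chevalley-core`, stub S4 (`stub_cmDeepUnitsReal`),
the one place on that line where the CM hypothesis enters: for a CM number field `K` there is a
rational modulus `a > 0` such that every unit `u` of `𝓞 K` with `a ∣ u - 1` is
(a) of infinite order unless `u = 1`, and (b) real under every complex embedding `φ : K →+* ℂ`,
i.e. `conj (φ u) = φ u`.

Proof (elementary, Mathlib only).  Take `a := 1 + ∑_{ζ ∈ μ(K)} |N_{K/ℚ}(ζ - 1)|`, a finite sum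
over the torsion subgroup `NumberField.Units.torsion K`.  If a natural number `n` divides a
non-zero algebraic integer `x` then `n ≤ n ^ [K:ℚ] = N(n) ≤ |N(x)|`
(`le_natAbs_norm_of_natCast_dvd`); hence no root of unity `ζ ≠ 1` satisfies `a ∣ ζ - 1`, which
is (a) (`exists_modulus_torsion_eq_one`).  For (b) let `ū` be the complex conjugate of `u`
(`NumberField.IsCMField.unitsComplexConj`); applying the conjugation to `a ∣ u - 1` gives
`a ∣ ū - 1`, so the root of unity `v := u ū⁻¹` (`IsCMField.unitsMulComplexConjInv`, valued in
`torsion K`) satisfies `a ∣ v - 1 = ū⁻¹ ((u - 1) - (ū - 1))`, whence `v = 1`, `ū = u`, and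
`conj (φ u) = φ ū = φ u` (`IsCMField.complexEmbedding_complexConj`).
No new definitions; Mathlib only.
-/

noncomputable section

set_option linter.dupNamespace false -- project-wide option (lakefile weak.linter.dupNamespace); `Summit.Langlands.Langlands` is the mandated namespace

open scoped NumberField ComplexConjugate
open NumberField NumberField.Units NumberField.IsCMField

namespace Summit.Langlands.Langlands.Theorems.HalfIntegralTwistCM

/-- If a natural number `n` divides a non-zero algebraic integer `x` of a number field `K`, then
`n ≤ |N_{K/ℚ}(x)|`: indeed `N(n) = n ^ [K:ℚ]` divides `N(x) ≠ 0`. [folklore] -/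
theorem le_natAbs_norm_of_natCast_dvd {K : Type*} [Field K] [NumberField K] {x : 𝓞 K}
    (hx : x ≠ 0) {n : ℕ} (h : (n : 𝓞 K) ∣ x) : n ≤ (Algebra.norm ℤ x).natAbs := by
  have h2 := Ideal.absNorm_dvd_norm_of_mem (Ideal.mem_span_singleton.mpr h)
  rw [Ideal.absNorm_span_natCast, Int.natCast_dvd] at h2
  have hN : (Algebra.norm ℤ x).natAbs ≠ 0 := by
    rwa [Ne, Int.natAbs_eq_zero, Algebra.norm_eq_zero_iff]
  have hd : Module.finrank ℤ (𝓞 K) ≠ 0 := by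
    rw [RingOfIntegers.rank]
    exact Module.finrank_pos.ne'
  exact (Nat.le_self_pow hd n).trans (Nat.le_of_dvd (Nat.pos_of_ne_zero hN) h2)

/-- **Roots of unity are shallow.** For a number field `K` there is `a > 0` in `ℕ` (namely
`1 + ∑_{ζ ∈ μ(K)} |N(ζ - 1)|`) such that the only root of unity `ζ` of `𝓞 K` with `a ∣ ζ - 1` is
`ζ = 1`: otherwise `a ≤ |N(ζ - 1)| < a` by `le_natAbs_norm_of_natCast_dvd`. [folklore] -/
theorem exists_modulus_torsion_eq_one (K : Type*) [Field K] [NumberField K] :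
    ∃ a : ℕ, 0 < a ∧ ∀ u : (𝓞 K)ˣ, u ∈ torsion K → (a : 𝓞 K) ∣ (u : 𝓞 K) - 1 → u = 1 := by
  classical
  haveI := Fintype.ofFinite (torsion K)
  refine ⟨1 + ∑ ζ : torsion K, (Algebra.norm ℤ (((ζ : (𝓞 K)ˣ) : 𝓞 K) - 1)).natAbs,
    Nat.add_pos_left Nat.one_pos _, fun u hu hdvd => ?_⟩
  by_contra hne
  have hx : (u : 𝓞 K) - 1 ≠ 0 := sub_ne_zero.mpr fun h => hne (Units.val_eq_one.mp h)
  have h1 := le_natAbs_norm_of_natCast_dvd hx hdvd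
  have h2 : (Algebra.norm ℤ ((u : 𝓞 K) - 1)).natAbs ≤
      ∑ ζ : torsion K, (Algebra.norm ℤ (((ζ : (𝓞 K)ˣ) : 𝓞 K) - 1)).natAbs :=
    Finset.single_le_sum_of_canonicallyOrdered
      (f := fun ζ : torsion K => (Algebra.norm ℤ (((ζ : (𝓞 K)ˣ) : 𝓞 K) - 1)).natAbs)
      (Finset.mem_univ (⟨u, hu⟩ : torsion K))
  omega

/-- **Deep units of a CM field are torsion-free and real** (stub S4 of the line
`two-primary-chevalley-core`, the one place where `IsCMField` is used).  For a CM number field `K`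
there is `a > 0` in `ℕ` such that every unit `u` of `𝓞 K` with `a ∣ u - 1` is (a) of infinite
order unless `u = 1` and (b) real under every complex embedding: `conj (φ u) = φ u` for all
`φ : K →+* ℂ`.  With `a` from `exists_modulus_torsion_eq_one`, (a) is immediate; for (b) the
conjugate `ū = unitsComplexConj K u` also satisfies `a ∣ ū - 1`, so the root of unity
`u ū⁻¹ = unitsMulComplexConjInv K u` is `≡ 1 (mod a)`, hence `1`, i.e. `ū = u`, and
`conj (φ u) = φ ū` (`complexEmbedding_complexConj`). [folklore] -/
theorem stub_cmDeepUnitsReal :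
    ∀ (K : Type) [Field K] [NumberField K], IsCMField K →
      ∃ a : ℕ, 0 < a ∧ ∀ u : (𝓞 K)ˣ, (a : 𝓞 K) ∣ (u : 𝓞 K) - 1 →
        (IsOfFinOrder u → u = 1) ∧
          ∀ φ : K →+* ℂ, conj (φ ((u : 𝓞 K) : K)) = φ ((u : 𝓞 K) : K) := by
  intro K _ _ hK
  haveI : IsCMField K := hK
  obtain ⟨a, ha, hmain⟩ := exists_modulus_torsion_eq_one K
  refine ⟨a, ha, fun u hu => ⟨fun hfin => hmain u ((CommGroup.mem_torsion u).mpr hfin) hu,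
    fun φ => ?_⟩⟩
  -- the complex conjugate `ū` of `u` satisfies `a ∣ ū - 1`
  have hconj : (a : 𝓞 K) ∣ ((unitsComplexConj K u : (𝓞 K)ˣ) : 𝓞 K) - 1 := by
    have h := map_dvd (RingOfIntegers.mapRingEquiv (complexConj K).toRingEquiv) hu
    rwa [map_natCast, map_sub, map_one] at h
  -- the root of unity `v = u ū⁻¹` satisfies `a ∣ v - 1`, hence `v = 1`
  have hv : (a : 𝓞 K) ∣ ((u * (unitsComplexConj K u)⁻¹ : (𝓞 K)ˣ) : 𝓞 K) - 1 := by
    have h1 : ((u * (unitsComplexConj K u)⁻¹ : (𝓞 K)ˣ) : 𝓞 K) - 1 =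
        (((unitsComplexConj K u)⁻¹ : (𝓞 K)ˣ) : 𝓞 K) *
          (((u : 𝓞 K) - 1) - (((unitsComplexConj K u : (𝓞 K)ˣ) : 𝓞 K) - 1)) := by
      rw [sub_sub_sub_cancel_right, mul_sub, Units.inv_mul, Units.val_mul, mul_comm]
    rw [h1]
    exact Dvd.dvd.mul_left (dvd_sub hu hconj) _
  have hv1 : u * (unitsComplexConj K u)⁻¹ = 1 := hmain _ (unitsMulComplexConjInv K u).2 hv
  have hfix : unitsComplexConj K u = u := (mul_inv_eq_one.mp hv1).symm
  -- hence `u` is fixed by the complex conjugation and is real under every complex embedding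
  have hfix' : complexConj K ((u : 𝓞 K) : K) = ((u : 𝓞 K) : K) :=
    congrArg (fun w : (𝓞 K)ˣ => ((w : 𝓞 K) : K)) hfix
  rw [← complexEmbedding_complexConj K φ, hfix']

end Summit.Langlands.Langlands.Theorems.HalfIntegralTwistCM

end
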